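import Mathlib

/-!
# Weighted-homogeneous evaluation on the corner slice (`Fin 3`, weights `(1, 2, 3)`)

Topic `RingTheory/MvPolynomial`; namespace `Literature.RingTheory.MvPolynomial`.  THEOREMS ONLY
(no `def`, no instance, no notation, no axiom, no named fact, no `sorry`); Mathlib-only imports.
Pure `MvPolynomial` algebra.  For a polynomial `Q` in three variables
`X 0, X 1, X 2` that is weighted homogeneous of weighted degree `d` for the weights
`(1, 2, 3)` — the weights of the elementary symmetric polynomials `e₁, e₂, e₃` of three
variables — its value on the *corner slice* `X 0 = 0` is the finite sum, over the pairs
`(i, j)` with `2 i + 3 j = d`, of `coeff (X 1 ^ i * X 2 ^ j) Q * (y₁ ^ i * y₂ ^ j)`: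
monomials containing `X 0` die, and the surviving exponents are pinned by the weight.

This is brick **B1-wh** of the in-house Glaeser–Chevalley road for `S₃` (symmetric smooth
functions of three real variables are smooth functions of `e₁, e₂, e₃`), where it is applied to
the Chevalley representatives `Q_d (e₁, e₂, e₃)` of the invariant Taylor forms at the corner.

## Main statements

* `weight_fin_three_eq` — the `(1, 2, 3)`-weight of `α : Fin 3 →₀ ℕ` is `α 0 + 2 α 1 + 3 α 2`.
* `eq_single_add_single_of_apply_zero_eq_zero` — an exponent with `α 0 = 0` is
  `single 1 (α 1) + single 2 (α 2)`.
* `eval_eq_sum_support_filter_of_apply_eq_zero` — generic: evaluating at a point with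
  `x i₀ = 0` only sees the monomials with `α i₀ = 0`.
* `eval_cons_zero_eq_sum_support_filter` — the `Fin 3` slice form over the support.
* `eval_eq_sum_filter_of_isWeightedHomogeneous` — the head: the slice value of a
  `(1, 2, 3)`-weighted homogeneous `Q` as an explicit sum over `2 i + 3 j = d`.

## References

* [Macdonald1995] I. G. Macdonald, *Symmetric functions and Hall polynomials*, 2nd ed., Oxford
  (1995), Ch. I §2, (2.4) and the Remark following it: `Λₙ = ℤ[e₁, …, eₙ]` with `e₁, …, eₙ`
  algebraically independent, graded with `eᵣ` of degree `r` — so a polynomial in `e₁, e₂, e₃`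
  representing a homogeneous symmetric polynomial of degree `d` is isobaric of weight `d` for the
  weights `(1, 2, 3)`; this file is the coordinate bookkeeping of that grading (Mathlib's
  `MvPolynomial.IsWeightedHomogeneous` with `w i = i + 1`) on the slice `e₁ = 0`.

What is NOT here: general `Fin n` ∕ general weights (only the generic vanishing lemma
`eval_eq_sum_support_filter_of_apply_eq_zero` is stated for any finite index type), the
fundamental theorem itself (Mathlib `MvPolynomial.esymmAlgEquiv`; cell file
`SymmetricVectorFormEsymm`), and any analysis.
-/

set_option autoImplicit false

namespace Literature.RingTheory.MvPolynomial

open MvPolynomial Finset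

/-- The `(1, 2, 3)`-weight of an exponent `α : Fin 3 →₀ ℕ` is `α 0 + 2 * α 1 + 3 * α 2` (the
degree of the monomial `e₁ ^ α 0 * e₂ ^ α 1 * e₃ ^ α 2` in the grading `deg eᵣ = r`). [cite: Macdonald1995, Ch. I §2 (2.4) + Remark (Λₙ = ℤ[e₁,…,eₙ] graded, deg eᵣ = r)] -/
theorem weight_fin_three_eq (α : Fin 3 →₀ ℕ) :
    Finsupp.weight (fun i : Fin 3 => (i : ℕ) + 1) α = α 0 + 2 * α 1 + 3 * α 2 := by
  rw [Finsupp.weight_apply, Finsupp.sum_fintype _ _ (fun _ => by simp)]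
  simp only [Fin.sum_univ_three, smul_eq_mul, Fin.val_zero, Fin.val_one, Fin.val_two]
  ring

/-- An exponent `α : Fin 3 →₀ ℕ` not involving the variable `X 0` is
`single 1 (α 1) + single 2 (α 2)` (exponent bookkeeping for the slice `e₁ = 0`). [cite: Macdonald1995, Ch. I §2 (2.4) + Remark (Λₙ = ℤ[e₁,…,eₙ] graded, deg eᵣ = r)] -/
theorem eq_single_add_single_of_apply_zero_eq_zero (α : Fin 3 →₀ ℕ) (h : α 0 = 0) :
    α = Finsupp.single 1 (α 1) + Finsupp.single 2 (α 2) := by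
  ext i
  fin_cases i
  · simpa using h
  · simp
  · simp

/-- **Monomials containing a variable evaluated at `0` die.**  For any point `x` with
`x i₀ = 0`, the evaluation of `Q` at `x` is the sum over the monomials of `Q` whose exponent
vanishes at `i₀` (generic coordinate form of «setting a generator to zero in a polynomial
ring»). [cite: Macdonald1995, Ch. I §2 (2.4) + Remark (Λₙ = ℤ[e₁,…,eₙ] graded, deg eᵣ = r)] -/
theorem eval_eq_sum_support_filter_of_apply_eq_zero {R σ : Type*} [CommSemiring R]
    [Fintype σ] (x : σ → R) (i₀ : σ) (hx : x i₀ = 0) (Q : MvPolynomial σ R) :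
    MvPolynomial.eval x Q =
      ∑ α ∈ Q.support.filter (fun α => α i₀ = 0), MvPolynomial.coeff α Q * ∏ i, x i ^ α i := by
  classical
  rw [MvPolynomial.eval_eq', Finset.sum_filter]
  refine Finset.sum_congr rfl fun α _ => ?_
  split_ifs with h
  · rfl
  · rw [← Finset.mul_prod_erase Finset.univ (fun i => x i ^ α i) (Finset.mem_univ i₀), hx,
      zero_pow h, zero_mul, mul_zero]

/-- **Corner slice, `Fin 3`.**  Evaluating `Q : MvPolynomial (Fin 3) R` at `(0, y₁, y₂)` only
sees the monomials `X 1 ^ i * X 2 ^ j`, with values `y₁ ^ i * y₂ ^ j`. [cite: Macdonald1995, Ch. I §2 (2.4) + Remark (Λₙ = ℤ[e₁,…,eₙ] graded, deg eᵣ = r)] -/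
theorem eval_cons_zero_eq_sum_support_filter {R : Type*} [CommSemiring R]
    (Q : MvPolynomial (Fin 3) R) (y₁ y₂ : R) :
    MvPolynomial.eval ![0, y₁, y₂] Q =
      ∑ α ∈ Q.support.filter (fun α => α 0 = 0),
        MvPolynomial.coeff α Q * (y₁ ^ α 1 * y₂ ^ α 2) := by
  rw [eval_eq_sum_support_filter_of_apply_eq_zero ![0, y₁, y₂] 0 rfl Q]
  refine Finset.sum_congr rfl fun α hα => ?_
  rw [Finset.mem_filter] at hα
  rw [Fin.prod_univ_three]
  simp [hα.2]

/-- **B1-wh: weighted-homogeneous evaluation on the corner slice.**  If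
`Q : MvPolynomial (Fin 3) ℝ` is weighted homogeneous of weighted degree `d` for the weights
`(1, 2, 3)` (`X i ↦ i + 1`), then its value at `(0, y₁, y₂)` is the explicit finite sum of
`coeff (X 1 ^ i * X 2 ^ j) Q * (y₁ ^ i * y₂ ^ j)` over the pairs `(i, j)` with `2 i + 3 j = d`
(indexed inside `range (d + 1) ×ˢ range (d + 1)`): the isobaric bookkeeping `deg eᵣ = r` of
the graded ring `ℤ[e₁, e₂, e₃]`, read on the slice `e₁ = 0`. [cite: Macdonald1995, Ch. I §2 (2.4) + Remark (Λₙ = ℤ[e₁,…,eₙ] graded, deg eᵣ = r)] -/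
theorem eval_eq_sum_filter_of_isWeightedHomogeneous (Q : MvPolynomial (Fin 3) ℝ) {d : ℕ}
    (hQ : Q.IsWeightedHomogeneous (fun i : Fin 3 => (i : ℕ) + 1) d) (y₁ y₂ : ℝ) :
    MvPolynomial.eval ![0, y₁, y₂] Q =
      ∑ ij ∈ ((Finset.range (d + 1)) ×ˢ (Finset.range (d + 1))).filter
          (fun ij : ℕ × ℕ => 2 * ij.1 + 3 * ij.2 = d),
        MvPolynomial.coeff (Finsupp.single 1 ij.1 + Finsupp.single 2 ij.2) Q *
          (y₁ ^ ij.1 * y₂ ^ ij.2) := by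
  rw [eval_cons_zero_eq_sum_support_filter]
  -- weight bookkeeping: a monomial of `Q` with `α 0 = 0` has `2 α 1 + 3 α 2 = d`
  have hwt : ∀ α ∈ Q.support.filter (fun α => α 0 = 0), 2 * α 1 + 3 * α 2 = d := by
    intro α hα
    rw [Finset.mem_filter, MvPolynomial.mem_support_iff] at hα
    have hw := hQ hα.1
    rw [weight_fin_three_eq, hα.2, zero_add] at hw
    exact hw
  refine Finset.sum_bij_ne_zero (fun α _ _ => (α 1, α 2)) ?_ ?_ ?_ ?_
  · -- lands in the index set
    intro α hα _
    have h := hwt α hα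
    simp only [Finset.mem_filter, Finset.mem_product, Finset.mem_range]
    exact ⟨⟨by omega, by omega⟩, h⟩
  · -- injective (both exponents vanish at `0`)
    intro α hα _ β hβ _ hαβ
    rw [Finset.mem_filter] at hα hβ
    simp only [Prod.mk.injEq] at hαβ
    rw [eq_single_add_single_of_apply_zero_eq_zero α hα.2,
      eq_single_add_single_of_apply_zero_eq_zero β hβ.2, hαβ.1, hαβ.2]
  · -- surjective onto the nonzero terms
    intro ij _ hne
    refine ⟨Finsupp.single 1 ij.1 + Finsupp.single 2 ij.2, ?_, ?_, ?_⟩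
    · rw [Finset.mem_filter, MvPolynomial.mem_support_iff]
      refine ⟨?_, by simp⟩
      exact left_ne_zero_of_mul hne
    · simpa using hne
    · simp
  · -- values agree
    intro α hα _
    rw [Finset.mem_filter] at hα
    conv_lhs => rw [eq_single_add_single_of_apply_zero_eq_zero α hα.2]
    simp

end Literature.RingTheory.MvPolynomial
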